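import Summits.HodgeConjecture.CorCM.Milne2020OfRiemann
import Literature.AlgebraicGeometry.HodgeTheory.WeilClassesCMReduction
import Literature.AlgebraicGeometry.HodgeTheory.AbelianVarietyMultiplicationPullback
import HarnessLib

/-!
# COR-CM (cell `pub-hodgecm2`), André 1992 — the WEAK record's conclusion on CM-typed products over
# one Galois CM field, and its transport along retractions (kernel, record-free)

HONEST FRAMING (cell pub-hodgecm2 / COR-CM, literature seat André, gen 3): a STRUCTURE statement about
Hodge classes of products of CM abelian varieties on the tree's real carriers; no case of the Hodge
conjecture is proved and nothing about algebraic cycles is asserted. This file is the record-free half of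
the derivation of the tree's weak André record
`HodgeTheory.Andre1992_hodgeClasses_cmAbelianVariety_mem_span_pullback_weilClasses`
(`Literature/AlgebraicGeometry/HodgeTheory/WeilClassesCMReduction.lean`; Charles–Schnell 2014 Thm. 11.5.21 /
Milne's endnote M.12 to Deligne 1982) from the ladder's displayed records; the companion
`CorCM/AndreWeakFormOfRiemann.lean` adds the decomposition/inflation step (Riemann's theorem).

CONTENTS (both PROVED, no definition, no named fact):

* **`andreWeak_cmTypedProduct`** — for `K` Galois CM with `2 < [K:ℚ]` and `B = ⨁_{i<n} A_i` a biproduct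
  of realisations of CM types of `K`, every rational `(k,k)` class on `B` lies in the `ℂ`-span of the
  weak record's target set AT `B` (its two members verbatim; the witness lands in the second — CM field
  `ℚ(ψ) ≅ ℚ[T]/(P)` of degree `e > 2`: `g = f_Δ`, `ψ = act(a₀)` on the twisted slot product `B_Δ` for an
  integer `a₀` separating the embeddings, `P = minpoly a₀`, `e = [K:ℚ]`, `w = t_Δ`). This is André's
  theorem in product form (KERNEL, seat gen 2:
  `AndreProductForm.andre1992_hodgeClasses_cmTypedProduct_mem_span_pullback_weilLines_holds`) re-read in
  the weak record's vocabulary through the lemmas of `CorCM/Milne2020OfRiemann.lean`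
  (`isGaloisCMFieldPoly_minpoly`: monic, degree, irreducible, no real root, one conjugation polynomial;
  `eval₂_diagHom_minpoly`: `P(ψ) = 0`; `weilLineClasses_le_weilClassesField`: `t_Δ ∈ W_F ⊗ ℂ`;
  `AndreProductForm.two_mul_dim_biproduct`: `e · 2k = 2 dim B_Δ`).
* **`mem_span_of_retraction`** — span membership of rational `(k,k)` classes in a pull-back-stable family
  of target sets descends along a retraction `s ≫ π = [N]_A`, `N ≠ 0` (`π^* c` is rational `(k,k)`,
  `s^* π^* c = N^{2k} c` by the tree's `complexBetti_map_nsmul_id_apply`) — the shape of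
  `CorCM.Domination.AVDominatedBy A P`, so that any domination of a CM abelian variety by such a
  product transfers the weak record's conclusion.

## References
* [CharlesSchnell2014Notes] F. Charles, C. Schnell, *Notes on absolute Hodge classes* (2014), Thm. 11.5.21
  and proof (pp. 510–511).
* [Deligne1982HodgeCycles] P. Deligne (notes by J. S. Milne), LNM 900 (1982), endnote M.12 (p. 64).
* [Milne2020HodgeClassesAV] J. S. Milne, arXiv:2010.08857, §3 Thm. 1 and proof.
* [Shimura1998] G. Shimura, *Abelian Varieties with Complex Multiplication and Modular Functions* (1998),
  §18.2 Lemma (i).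
* [MoonenZarhin1998WeilClasses] B. Moonen, Yu. Zarhin, Crelle 496 (1998), §1 (`W_F ⊗ ℂ = ⊕_σ ⋀^r V_σ`).
* [MumfordAV1970] D. Mumford, *Abelian Varieties* (1970), §19 (`[N]^*`, isogeny factors).
-/

noncomputable section

namespace Summit.HodgeConjecture.CorCM.AndreWeakForm

open CategoryTheory CategoryTheory.Limits Polynomial NumberField
open Literature.AlgebraicGeometry Literature.AlgebraicGeometry.Motives Literature.AlgebraicGeometry.HodgeTheory
open Literature.AlgebraicGeometry.ComplexMultiplication
open Literature.NumberTheory.Automorphic.PicardCM (eigenline)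
open Summit.HodgeConjecture.CorCM.AndreProductForm Summit.HodgeConjecture.CorCM.Milne2020

/-! ## André's theorem in product form, re-read in the weak record's vocabulary -/

section Product

variable (K : Type) [Field K] [NumberField K] [IsCMField K] [IsGalois ℚ K]

/-- **The weak record's conclusion on a CM-typed product over one Galois CM field of degree `> 2`.**
For `B = ⨁_{i<n} A_i`, `(A_i, ι_i, θ_i)` realising CM types `Φ_i` of `K` (`K` Galois CM, `2 < [K:ℚ]`),
every rational class of Hodge type `(k,k)` in `H^{2k}(B(ℂ); ℂ)` lies in the `ℂ`-span of the target
set of `HodgeTheory.Andre1992_hodgeClasses_cmAbelianVariety_mem_span_pullback_weilClasses` AT `B`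
(verbatim its two members; only the second — CM field `ℚ(ψ) ≅ ℚ[T]/(P)` of degree `e > 2` — is
used): by André's theorem in product form (kernel,
`AndreProductForm.andre1992_hodgeClasses_cmTypedProduct_mem_span_pullback_weilLines_holds`) the class is
a combination of `f_Δ^*(t)`, `t` a rational `(k,k)` `K`-Weil-line class on the twisted slot product
`B_Δ = ⨁_j A_{i_j}`; and `(B_Δ, f_Δ, ψ = act(a₀), P = minpoly a₀, e = [K:ℚ], t)` is a member of the
second target set: `P` monic irreducible of degree `e` with no real root and one conjugation polynomial
(`Milne2020.isGaloisCMFieldPoly_minpoly`), `P(ψ) = 0` (`Milne2020.eval₂_diagHom_minpoly`),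
`e · 2k = 2 dim B_Δ` (`AndreProductForm.two_mul_dim_biproduct`), `t ∈ W_F ⊗ ℂ`
(`Milne2020.weilLineClasses_le_weilClassesField`).
[cite: CharlesSchnell2014Notes, Thm. 11.5.21 and proof (pp. 510–511)]
[cite: Deligne1982HodgeCycles, endnote M.12 (p. 64)] [cite: Milne2020HodgeClassesAV, §3 Thm. 1 and proof]
[cite: Shimura1998, §18.2 Lemma (i)] -/
theorem andreWeak_cmTypedProduct (hK : 2 < Module.finrank ℚ K) {n : ℕ} (A : Fin n → AbelianVariety ℂ)
    (Φ : Fin n → CMType K) (ι : ∀ i, 𝓞 K →+* End (A i))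
    (θ : ∀ i, K →+* Module.End ℂ (complexBetti (A i).X 1))
    (hA : ∀ i, IsCMTypeRealisation (Φ i) (A i) (ι i) (θ i)) (k : ℕ)
    (c : complexBetti (⨁ A).X (2 * k)) (hcQ : IsRationalClass c)
    (hcH : IsOfHodgeType (⨁ A).dim (⨁ A).X (2 * k) k k c) :
    c ∈ Submodule.span ℂ
        ({c' : complexBetti (⨁ A).X (2 * k) |
            ∃ (B : Motives.AbelianVariety ℂ) (g : (⨁ A).X ⟶ B.X) (d : ℕ) (ψ : B ⟶ B)
              (w : complexBetti B.X (2 * k)),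
              B.dim = 2 * k ∧ 0 < d ∧ ψ ≫ ψ = -(d • 𝟙 B) ∧ IsRationalClass w ∧
                IsOfHodgeType (2 * k) B.X (2 * k) k k w ∧ w ∈ weilClassesOf B ψ k d ∧
                c' = complexBetti.map g (2 * k) w} ∪
         {c' : complexBetti (⨁ A).X (2 * k) |
            ∃ (B : Motives.AbelianVariety ℂ) (g : (⨁ A).X ⟶ B.X) (ψ : B ⟶ B) (P : Polynomial ℤ) (e : ℕ)
              (w : complexBetti B.X (2 * k)),
              P.Monic ∧ P.natDegree = e ∧ 2 < e ∧ Irreducible (P.map (Int.castRingHom ℚ)) ∧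
                Polynomial.eval₂ (Int.castRingHom (CategoryTheory.End B)) (ψ : CategoryTheory.End B) P = 0 ∧
                e * (2 * k) = 2 * B.dim ∧
                (∀ ρ : ℂ, Polynomial.eval₂ (Int.castRingHom ℂ) ρ P = 0 → starRingEnd ℂ ρ ≠ ρ) ∧
                (∃ Q : Polynomial ℚ, ∀ ρ : ℂ, Polynomial.eval₂ (Int.castRingHom ℂ) ρ P = 0 →
                    Polynomial.eval₂ (algebraMap ℚ ℂ) ρ Q = starRingEnd ℂ ρ) ∧
                w ∈ weilClassesField B ψ P (2 * k) ∧ IsRationalClass w ∧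
                IsOfHodgeType B.dim B.X (2 * k) k k w ∧ c' = complexBetti.map g (2 * k) w}) := by
  classical
  -- André's theorem in product form (kernel)
  have h := andre1992_hodgeClasses_cmTypedProduct_mem_span_pullback_weilLines_holds K n A Φ ι θ hA k c
    hcQ hcH
  refine Submodule.span_mono ?_ h
  rintro _ ⟨i, e, t, -, -, htQ, htH, htW, rfl⟩
  refine Or.inr ?_
  -- the separating integer and its minimal polynomial, a Galois CM field polynomial of degree `[K:ℚ]`
  obtain ⟨a₀, hsep⟩ := exists_integer_separating K
  obtain ⟨hPm, hPe, -, hPirr, hreal, hQ, -⟩ := isGaloisCMFieldPoly_minpoly K a₀ hsep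
  -- the twisted slot product and its diagonal action
  let Bs : Fin (2 * k) → AbelianVariety ℂ := fun j => A (i j)
  let act : ∀ j, 𝓞 K →+* End (Bs j) :=
    fun j => (ι (i j)).comp (RingOfIntegers.mapRingEquiv (e j).symm).toRingHom
  -- bases of `H¹` of the slots (for the dimension count)
  have hv : ∀ i₀ : Fin n, ∃ v : Module.Basis (K →+* ℂ) ℂ (complexBetti (A i₀).X 1),
      ∀ σ, v σ ∈ eigenline (θ i₀) σ := fun i₀ => exists_eigenbasis (hA i₀)
  choose v hv using hv
  have hdim : Module.finrank ℚ K * (2 * k) = 2 * (⨁ Bs).dim := by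
    rw [two_mul_dim_biproduct Bs (fun j => v (i j)), Fintype.card_fin, ← NumberField.Embeddings.card K ℂ,
      mul_comm]
  exact ⟨⨁ Bs, (multiDiagonal A i).hom.hom.hom, diagHom K Bs act a₀, minpoly ℤ a₀, Module.finrank ℚ K, t,
    hPm, hPe, hK, hPirr, eval₂_diagHom_minpoly K Bs act a₀, hdim, hreal, hQ,
    weilLineClasses_le_weilClassesField K Bs act a₀ (2 * k) htW, htQ, htH, rfl⟩

end Product

/-! ## Transport of span membership along a retraction `s ≫ π = [N]` -/

section Transport

/-- **Span membership of rational `(k,k)` classes in a pull-back-stable family of target sets descends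
along a retraction.** If `S X ⊆ H^{2k}(X(ℂ); ℂ)` is a family of sets, indexed by complex abelian
varieties, stable under pull-backs along `ℂ`-morphisms `X.X ⟶ Y.X`, and `s : A → P`, `π : P → A` are
homomorphisms with `π ∘ s = [N]_A`, `N ≠ 0` (`A` an isogeny factor of `P`), then: if every rational
`(k,k)` class on `P` lies in `span (S P)`, every rational `(k,k)` class `c` on `A` lies in `span (S A)` —
`π^* c` is rational of type `(k,k)` (pull-backs preserve both), `s^*` maps `span (S P)` into `span (S A)`,
and `s^* π^* c = [N]^* c = N^{2k} c` (the tree's `complexBetti_map_nsmul_id_apply`, Mumford §19).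
[cite: MumfordAV1970, §19 (isogeny factors; [N]^*)] -/
theorem mem_span_of_retraction {k : ℕ} (S : ∀ X : AbelianVariety ℂ, Set (complexBetti X.X (2 * k)))
    (hS : ∀ (X Y : AbelianVariety ℂ) (g : X.X ⟶ Y.X) (w : complexBetti Y.X (2 * k)),
      w ∈ S Y → complexBetti.map g (2 * k) w ∈ S X)
    {A P : AbelianVariety ℂ} (s : A ⟶ P) (π : P ⟶ A) {N : ℕ} (hN : N ≠ 0) (hsπ : s ≫ π = N • 𝟙 A)
    (hP : ∀ c : complexBetti P.X (2 * k), IsRationalClass c → IsOfHodgeType P.dim P.X (2 * k) k k c →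
      c ∈ Submodule.span ℂ (S P))
    (c : complexBetti A.X (2 * k)) (hcQ : IsRationalClass c) (hcH : IsOfHodgeType A.dim A.X (2 * k) k k c) :
    c ∈ Submodule.span ℂ (S A) := by
  have hAsp : IsSmoothProjective A.dim A.X := AbelianVariety.isSmoothProjective_holds (A := A)
  have hPsp : IsSmoothProjective P.dim P.X := AbelianVariety.isSmoothProjective_holds (A := P)
  -- `π^* c` is rational of type `(k,k)`
  set c' : complexBetti P.X (2 * k) := complexBetti.map π.hom.hom.hom (2 * k) c with hc'
  have hc'Q : IsRationalClass c' := hcQ.pullback _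
  have hc'H : IsOfHodgeType P.dim P.X (2 * k) k k c' := hcH.map_of_isSmoothProjective hPsp hAsp _
  have h1 : c' ∈ Submodule.span ℂ (S P) := hP c' hc'Q hc'H
  -- `s^* π^* c = N^{2k} • c`
  have h2 : complexBetti.map s.hom.hom.hom (2 * k) c' = ((N : ℂ) ^ (2 * k)) • c := by
    rw [hc', ← CategoryTheory.comp_apply, ← complexBetti_map_comp_hom, hsπ]
    exact complexBetti_map_nsmul_id_apply A N (2 * k) c
  -- `s^*` maps `span (S P)` into `span (S A)`
  have h3 : (Submodule.span ℂ (S P)).map (complexBetti.map s.hom.hom.hom (2 * k)).hom ≤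
      Submodule.span ℂ (S A) := by
    rw [Submodule.map_span_le]
    intro w hw
    exact Submodule.subset_span (hS A P s.hom.hom.hom w hw)
  have h4 : ((N : ℂ) ^ (2 * k)) • c ∈ Submodule.span ℂ (S A) := by
    rw [← h2]
    exact h3 (Submodule.mem_map_of_mem h1)
  have hNc : ((N : ℂ) ^ (2 * k)) ≠ 0 := pow_ne_zero _ (Nat.cast_ne_zero.mpr hN)
  exact (Submodule.smul_mem_iff _ hNc).mp h4

end Transport

end Summit.HodgeConjecture.CorCM.AndreWeakForm

end
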